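import Literature.Analysis.Fourier.HilbertTransformCircleHolomorphic
import Literature.Analysis.Fourier.HilbertTransformCircleTrigPoly
import Mathlib.Analysis.SpecialFunctions.Trigonometric.Arctan
import HarnessLib

/-!
# Conformal covariance of the periodic Hilbert transform under disc automorphisms

Topic `Literature/Analysis/Fourier`. Let `Φ_ρ(w) = (w − ρ)/(1 − ρw)` (`ρ` real, `|ρ| < 1`) be the automorphism of the unit disc
fixing `±1`, and let `φ : ℝ → ℝ` be any real lift of its boundary map, `e^{iφ(y)} = Φ_ρ(e^{iy})` (for instance
`φ(y) = y + 2 arctan(ρ sin y/(1 − ρ cos y))`, `cexp_moebiusLift_mul_I`; on `(−π, π)` this is the map `2 arctan(s tan(y/2))`,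
`ρ = (s−1)/(s+1)`). For the p.v. operator `H = hilbertTransformCircle` (`HilbertTransformCircle.lean`, `H cos = sin`) and a function
`f(θ) = Re g(e^{iθ})` with `g` holomorphic on a neighbourhood of the closed unit disc,

  `H[f ∘ φ](x) = (Hf)(φ(x)) + (Im g(0) − Im g(−ρ))`     (`hilbertTransformCircle_re_moebius`)

— the conjugate function is conformally covariant up to the constant `Im g(Φ_ρ(0)) − Im g(0)`, because `g ∘ Φ_ρ` is again
holomorphic near the closed disc and `hilbertTransformCircle_re_eq_im` applies to both `g` and `g ∘ Φ_ρ`. In the letters of the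
tree's trigonometric polynomials (`HilbertTransformCircleTrigPoly.lean`):

  `H[c + Σ_{k<n} (α_k sin((k+1)φ(·)) + β_k cos((k+1)φ(·)))](x) = Σ_{k<n} (−α_k cos((k+1)φ(x)) + β_k sin((k+1)φ(x))) + Σ_{k<n} α_k (−ρ)^{k+1}`

(`hilbertTransformCircle_trigPoly_moebius`). This is the exact identity used by conformally adapted («co-moving Möbius»)
Fourier collocation schemes for 1-D non-local models on `𝕋` to evaluate `H` in the mapped variable (the Hilbert transform in the
physical variable equals the Fourier-multiplier transform in the mapped variable minus a rank-one correction).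
Classical: conformal invariance of harmonic conjugates [cite: Katznelson2004, Ch. III §1]; no definitions, no named facts.
-/

noncomputable section

namespace Literature.Analysis.Fourier

open _root_.Complex Set Metric
open scoped Real

/-! ### The disc automorphism `Φ_ρ(w) = (w − ρ)/(1 − ρ w)` -/

/-- For `|ρ| < 1` and `‖w‖ ≤ 1` the denominator `1 − ρw` does not vanish (helper). [folklore] -/
private theorem one_sub_mul_ne_zero {ρ : ℝ} (hρ : |ρ| < 1) {w : ℂ} (hw : ‖w‖ ≤ 1) : (1 : ℂ) - ρ * w ≠ 0 := by
  intro h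
  have h1 : (ρ : ℂ) * w = 1 := (sub_eq_zero.mp h).symm
  have h2 : ‖(ρ : ℂ) * w‖ = 1 := by rw [h1, norm_one]
  rw [norm_mul, Complex.norm_real, Real.norm_eq_abs] at h2
  have h3 : |ρ| * ‖w‖ ≤ |ρ| * 1 := by gcongr
  linarith

/-- `Φ_ρ` maps the closed unit disc into itself: `‖(w − ρ)/(1 − ρw)‖ ≤ 1` for `‖w‖ ≤ 1`
(`|1 − ρw|² − |w − ρ|² = (1 − ρ²)(1 − |w|²) ≥ 0`). [folklore] -/
private theorem norm_moebius_le_one {ρ : ℝ} (hρ : |ρ| < 1) {w : ℂ} (hw : ‖w‖ ≤ 1) :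
    ‖(w - ρ) / (1 - ρ * w)‖ ≤ 1 := by
  have hne := one_sub_mul_ne_zero hρ hw
  rw [norm_div, div_le_one (norm_pos_iff.mpr hne)]
  rw [← sq_le_sq₀ (norm_nonneg _) (norm_nonneg _), Complex.sq_norm, Complex.sq_norm,
    Complex.normSq_apply, Complex.normSq_apply]
  have hw2 : w.re * w.re + w.im * w.im ≤ 1 := by
    have h := Complex.sq_norm w
    rw [Complex.normSq_apply] at h
    have : ‖w‖ ^ 2 ≤ 1 := by
      calc ‖w‖ ^ 2 ≤ 1 ^ 2 := by gcongr
        _ = 1 := one_pow 2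
    linarith
  have hρ2 : ρ ^ 2 < 1 := by
    have := abs_lt.mp hρ
    nlinarith
  simp only [Complex.sub_re, Complex.sub_im, Complex.ofReal_re, Complex.ofReal_im, Complex.mul_re, Complex.mul_im,
    Complex.one_re, Complex.one_im, sub_zero, zero_mul, add_zero]
  nlinarith [mul_nonneg (sub_nonneg.mpr hρ2.le) (sub_nonneg.mpr hw2)]

/-- `Φ_ρ` is complex-differentiable away from the pole (helper). [folklore] -/
private theorem differentiableOn_moebius (ρ : ℝ) :
    DifferentiableOn ℂ (fun w : ℂ => (w - ρ) / (1 - ρ * w)) {w : ℂ | (1 : ℂ) - ρ * w ≠ 0} :=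
  DifferentiableOn.div (by fun_prop) (by fun_prop) fun _ hw => hw

/-! ### Conformal covariance of the conjugate function -/

/-- **Conformal covariance of the periodic Hilbert transform.** Let `g` be holomorphic on an open neighbourhood `U` of the
closed unit disc, `|ρ| < 1`, and `φ : ℝ → ℝ` any lift of the boundary map of `Φ_ρ(w) = (w − ρ)/(1 − ρw)`, i.e.
`e^{iφ(y)} = Φ_ρ(e^{iy})` for all `y`. Then for every `x`
`H[y ↦ Re g(e^{iφ(y)})](x) = H[θ ↦ Re g(e^{iθ})](φ(x)) + (Im g(0) − Im g(−ρ))`: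
composing with the boundary map of a disc automorphism changes the conjugate function only by the constant
`Im g(0) − Im g(Φ_ρ(0))` (both sides are `Im (g ∘ Φ_ρ)` resp. `Im g` on the circle by `hilbertTransformCircle_re_eq_im`).
[cite: Katznelson2004, Ch. III §1 (conjugate function of the real part of a function analytic near the closed disc; applied to
`g` and `g ∘ Φ_ρ`)] -/
theorem hilbertTransformCircle_re_moebius {g : ℂ → ℂ} {U : Set ℂ} (hU : IsOpen U) (hsub : closedBall (0 : ℂ) 1 ⊆ U)
    (hg : DifferentiableOn ℂ g U) {ρ : ℝ} (hρ : |ρ| < 1) {φ : ℝ → ℝ}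
    (hφ : ∀ y : ℝ, Complex.exp (φ y * I) = (Complex.exp (y * I) - ρ) / (1 - ρ * Complex.exp (y * I))) (x : ℝ) :
    hilbertTransformCircle (fun y : ℝ => (g (Complex.exp (φ y * I))).re) x
      = hilbertTransformCircle (fun θ : ℝ => (g (Complex.exp (θ * I))).re) (φ x) + ((g 0).im - (g (-ρ)).im) := by
  set Φ : ℂ → ℂ := fun w => (w - ρ) / (1 - ρ * w) with hΦ
  set V : Set ℂ := {w : ℂ | (1 : ℂ) - ρ * w ≠ 0} ∩ Φ ⁻¹' U with hV
  have hVopen : IsOpen V :=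
    (differentiableOn_moebius ρ).continuousOn.isOpen_inter_preimage (isOpen_ne_fun (by fun_prop) (by fun_prop)) hU
  have hVsub : closedBall (0 : ℂ) 1 ⊆ V := by
    intro w hw
    rw [mem_closedBall_zero_iff] at hw
    exact ⟨one_sub_mul_ne_zero hρ hw, hsub (mem_closedBall_zero_iff.mpr (norm_moebius_le_one hρ hw))⟩
  have hG : DifferentiableOn ℂ (g ∘ Φ) V :=
    hg.comp ((differentiableOn_moebius ρ).mono inter_subset_left) fun w hw => hw.2
  have key := hilbertTransformCircle_re_eq_im hVopen hVsub hG x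
  have hfun : (fun y : ℝ => ((g ∘ Φ) (Complex.exp (y * I))).re) = fun y : ℝ => (g (Complex.exp (φ y * I))).re := by
    funext y
    simp only [Function.comp_apply, hΦ, hφ]
  have h0 : (g ∘ Φ) 0 = g (-ρ) := by simp [hΦ]
  have hx : (g ∘ Φ) (Complex.exp (x * I)) = g (Complex.exp (φ x * I)) := by
    simp only [Function.comp_apply, hΦ, hφ x]
  rw [hfun, h0, hx] at key
  rw [key, hilbertTransformCircle_re_eq_im hU hsub hg (φ x)]
  ring

/-- The same with an almost-everywhere lift: if `e^{iφ(y)} = Φ_ρ(e^{iy})` for a.e. `y` and at the point `x`, the identity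
`H[y ↦ Re g(e^{iφ(y)})](x) = H[θ ↦ Re g(e^{iθ})](φ(x)) + (Im g(0) − Im g(−ρ))` still holds (the operator only sees a.e.-classes,
`hilbertTransformCircle_congr_ae`). This covers lifts such as `2 arctan(s tan(y/2))` that are correct off a null set.
[cite: Katznelson2004, Ch. III §1] -/
theorem hilbertTransformCircle_re_moebius_ae {g : ℂ → ℂ} {U : Set ℂ} (hU : IsOpen U) (hsub : closedBall (0 : ℂ) 1 ⊆ U)
    (hg : DifferentiableOn ℂ g U) {ρ : ℝ} (hρ : |ρ| < 1) {φ : ℝ → ℝ}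
    (hφ : ∀ᵐ y : ℝ, Complex.exp (φ y * I) = (Complex.exp (y * I) - ρ) / (1 - ρ * Complex.exp (y * I))) {x : ℝ}
    (hx : Complex.exp (φ x * I) = (Complex.exp (x * I) - ρ) / (1 - ρ * Complex.exp (x * I))) :
    hilbertTransformCircle (fun y : ℝ => (g (Complex.exp (φ y * I))).re) x
      = hilbertTransformCircle (fun θ : ℝ => (g (Complex.exp (θ * I))).re) (φ x) + ((g 0).im - (g (-ρ)).im) := by
  set Φ : ℂ → ℂ := fun w => (w - ρ) / (1 - ρ * w) with hΦ
  set V : Set ℂ := {w : ℂ | (1 : ℂ) - ρ * w ≠ 0} ∩ Φ ⁻¹' U with hV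
  have hVopen : IsOpen V :=
    (differentiableOn_moebius ρ).continuousOn.isOpen_inter_preimage (isOpen_ne_fun (by fun_prop) (by fun_prop)) hU
  have hVsub : closedBall (0 : ℂ) 1 ⊆ V := by
    intro w hw
    rw [mem_closedBall_zero_iff] at hw
    exact ⟨one_sub_mul_ne_zero hρ hw, hsub (mem_closedBall_zero_iff.mpr (norm_moebius_le_one hρ hw))⟩
  have hG : DifferentiableOn ℂ (g ∘ Φ) V :=
    hg.comp ((differentiableOn_moebius ρ).mono inter_subset_left) fun w hw => hw.2
  have key := hilbertTransformCircle_re_eq_im hVopen hVsub hG x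
  have hae : (fun y : ℝ => (g (Complex.exp (φ y * I))).re) =ᵐ[MeasureTheory.volume]
      fun y : ℝ => ((g ∘ Φ) (Complex.exp (y * I))).re := by
    filter_upwards [hφ] with y hy
    simp only [Function.comp_apply, hΦ, hy]
  have h0 : (g ∘ Φ) 0 = g (-ρ) := by simp [hΦ]
  have hx' : (g ∘ Φ) (Complex.exp (x * I)) = g (Complex.exp (φ x * I)) := by
    simp only [Function.comp_apply, hΦ, hx]
  rw [hilbertTransformCircle_congr_ae hae x, key, h0, hx', hilbertTransformCircle_re_eq_im hU hsub hg (φ x)]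
  ring

/-! ### An explicit real-analytic lift of the boundary map -/

/-- `e^{2i arctan q} = (1 + iq)/(1 − iq)` (helper). [folklore] -/
private theorem cexp_two_arctan_mul_I (q : ℝ) :
    Complex.exp (((2 * Real.arctan q : ℝ) : ℂ) * I) = (1 + q * I) / (1 - q * I) := by
  have hne : (1 : ℂ) - q * I ≠ 0 := by
    intro h
    have := congrArg Complex.re h
    simp at this
  have hq2 : (0 : ℝ) < 1 + q ^ 2 := by positivity
  have hsq : Real.sqrt (1 + q ^ 2) ^ 2 = 1 + q ^ 2 := Real.sq_sqrt hq2.le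
  have hsq0 : Real.sqrt (1 + q ^ 2) ≠ 0 := by positivity
  have hcos : Real.cos (2 * Real.arctan q) = (1 - q ^ 2) / (1 + q ^ 2) := by
    rw [Real.cos_two_mul, Real.cos_sq_arctan]
    field_simp
    ring
  have hsc : Real.sin (Real.arctan q) * Real.cos (Real.arctan q) = q / (1 + q ^ 2) := by
    rw [Real.sin_arctan, Real.cos_arctan, div_mul_div_comm, mul_one, ← pow_two, hsq]
  have hsin : Real.sin (2 * Real.arctan q) = 2 * q / (1 + q ^ 2) := by
    rw [Real.sin_two_mul, mul_assoc, hsc]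
    ring
  rw [Complex.exp_mul_I, ← Complex.ofReal_cos, ← Complex.ofReal_sin, hcos, hsin, eq_div_iff hne]
  have hD : (1 : ℝ) + q ^ 2 ≠ 0 := hq2.ne'
  apply Complex.ext
  · simp only [Complex.mul_re, Complex.add_re, Complex.add_im, Complex.mul_im, Complex.ofReal_re, Complex.ofReal_im,
      Complex.I_re, Complex.I_im, Complex.one_re, Complex.one_im, Complex.sub_re, Complex.sub_im]
    field_simp
    ring
  · simp only [Complex.mul_re, Complex.add_re, Complex.add_im, Complex.mul_im, Complex.ofReal_re, Complex.ofReal_im,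
      Complex.I_re, Complex.I_im, Complex.one_re, Complex.one_im, Complex.sub_re, Complex.sub_im]
    field_simp
    ring

/-- **An explicit lift.** For `|ρ| < 1` the real-analytic function `φ_ρ(y) = y + 2 arctan(ρ sin y/(1 − ρ cos y))` lifts the boundary
map of `Φ_ρ`: `e^{iφ_ρ(y)} = (e^{iy} − ρ)/(1 − ρ e^{iy})` for every real `y` (write `1 ± iq = (1 − ρe^{∓iy})/(1 − ρ cos y)`).
On `(−π, π)` it coincides with `2 arctan(s tan(y/2))`, `s = (1+ρ)/(1−ρ)`. [folklore] -/
private theorem cexp_moebiusLift_mul_I_aux {ρ : ℝ} (hρ : |ρ| < 1) (y : ℝ) :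
    Complex.exp (((y + 2 * Real.arctan (ρ * Real.sin y / (1 - ρ * Real.cos y)) : ℝ) : ℂ) * I)
      = (Complex.exp (y * I) - ρ) / (1 - ρ * Complex.exp (y * I)) := by
  set q : ℝ := ρ * Real.sin y / (1 - ρ * Real.cos y) with hq
  have hc : 0 < 1 - ρ * Real.cos y := by
    have h1 : ρ * Real.cos y ≤ |ρ * Real.cos y| := le_abs_self _
    have h2 : |ρ * Real.cos y| ≤ |ρ| := by
      rw [abs_mul]
      calc |ρ| * |Real.cos y| ≤ |ρ| * 1 := by gcongr; exact Real.abs_cos_le_one y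
        _ = |ρ| := mul_one _
    linarith
  have hne : (1 : ℂ) - ρ * Complex.exp (y * I) ≠ 0 :=
    one_sub_mul_ne_zero hρ (by rw [Complex.norm_exp_ofReal_mul_I])
  -- split the exponential
  have hsplit : Complex.exp (((y + 2 * Real.arctan q : ℝ) : ℂ) * I)
      = Complex.exp (y * I) * Complex.exp (((2 * Real.arctan q : ℝ) : ℂ) * I) := by
    rw [← Complex.exp_add]
    congr 1
    push_cast
    ring
  rw [hsplit, cexp_two_arctan_mul_I q]
  -- `1 + iq = (c + iρ sin y)/c`, `1 − iq = (c − iρ sin y)/c` with `c = 1 − ρ cos y`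
  have hc' : ((1 - ρ * Real.cos y : ℝ) : ℂ) ≠ 0 := by exact_mod_cast hc.ne'
  have hc'' : (1 : ℂ) - (ρ : ℂ) * Complex.cos (y : ℂ) ≠ 0 := by
    rw [← Complex.ofReal_cos]
    exact_mod_cast hc.ne'
  have hnum : (1 : ℂ) + q * I = (((1 - ρ * Real.cos y : ℝ) : ℂ) + ((ρ * Real.sin y : ℝ) : ℂ) * I)
      / ((1 - ρ * Real.cos y : ℝ) : ℂ) := by
    rw [eq_div_iff hc', hq]
    push_cast
    field_simp
  have hden : (1 : ℂ) - q * I = (((1 - ρ * Real.cos y : ℝ) : ℂ) - ((ρ * Real.sin y : ℝ) : ℂ) * I)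
      / ((1 - ρ * Real.cos y : ℝ) : ℂ) := by
    rw [eq_div_iff hc', hq]
    push_cast
    field_simp
  -- `c − iρ sin y = 1 − ρ e^{iy}` and `e^{iy}(c + iρ sin y) = e^{iy} − ρ`
  have hden' : ((1 - ρ * Real.cos y : ℝ) : ℂ) - ((ρ * Real.sin y : ℝ) : ℂ) * I = 1 - ρ * Complex.exp (y * I) := by
    rw [Complex.exp_mul_I, ← Complex.ofReal_cos, ← Complex.ofReal_sin]
    push_cast
    ring
  have hnum' : Complex.exp (y * I) * (((1 - ρ * Real.cos y : ℝ) : ℂ) + ((ρ * Real.sin y : ℝ) : ℂ) * I)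
      = Complex.exp (y * I) - ρ := by
    have hcs : Complex.cos (y : ℂ) ^ 2 + Complex.sin (y : ℂ) ^ 2 = 1 := Complex.cos_sq_add_sin_sq _
    rw [Complex.exp_mul_I]
    push_cast
    linear_combination (-(ρ : ℂ)) * hcs + (ρ : ℂ) * Complex.sin (y : ℂ) ^ 2 * Complex.I_sq
  rw [hnum, hden, div_div_div_cancel_right₀ hc', mul_div_assoc', hnum', hden']

/-- **An explicit lift.** For `|ρ| < 1` the real-analytic function `φ_ρ(y) = y + 2 arctan(ρ sin y/(1 − ρ cos y))` lifts the
boundary map of the disc automorphism `Φ_ρ(w) = (w − ρ)/(1 − ρw)`: `e^{iφ_ρ(y)} = (e^{iy} − ρ)/(1 − ρ e^{iy})` for every real `y`.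
[cite: Katznelson2004, Ch. III §1 (boundary correspondence of a Möbius automorphism of the disc)] -/
theorem cexp_moebiusLift_mul_I {ρ : ℝ} (hρ : |ρ| < 1) (y : ℝ) :
    Complex.exp (((y + 2 * Real.arctan (ρ * Real.sin y / (1 - ρ * Real.cos y)) : ℝ) : ℂ) * I)
      = (Complex.exp (y * I) - ρ) / (1 - ρ * Complex.exp (y * I)) :=
  cexp_moebiusLift_mul_I_aux hρ y

/-! ### Trigonometric polynomials -/

/-- Real part of `e^{iθ}^m` (helper). [folklore] -/
private theorem exp_mul_I_pow_re' (θ : ℝ) (m : ℕ) :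
    (Complex.exp (θ * I) ^ m).re = Real.cos ((m : ℝ) * θ) := by
  rw [← Complex.exp_nat_mul, show (m : ℂ) * (θ * I) = (((m : ℝ) * θ : ℝ) : ℂ) * I by push_cast; ring,
    Complex.exp_ofReal_mul_I_re]

/-- Imaginary part of `e^{iθ}^m` (helper). [folklore] -/
private theorem exp_mul_I_pow_im' (θ : ℝ) (m : ℕ) :
    (Complex.exp (θ * I) ^ m).im = Real.sin ((m : ℝ) * θ) := by
  rw [← Complex.exp_nat_mul, show (m : ℂ) * (θ * I) = (((m : ℝ) * θ : ℝ) : ℂ) * I by push_cast; ring,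
    Complex.exp_ofReal_mul_I_im]

/-- **Conformal covariance for trigonometric polynomials.** For `|ρ| < 1`, any lift `φ` of the boundary map of `Φ_ρ`
(`e^{iφ(y)} = (e^{iy} − ρ)/(1 − ρe^{iy})`), every `n`, constant `c` and coefficients `α, β`:
`H[c + Σ_{k<n} (α_k sin((k+1)φ(·)) + β_k cos((k+1)φ(·)))](x) = Σ_{k<n} (−α_k cos((k+1)φ(x)) + β_k sin((k+1)φ(x))) + Σ_{k<n} α_k (−ρ)^{k+1}`
— the multiplier `−i sgn k` in the mapped variable plus the constant `−Im G(−ρ)`, `G(w) = c + Σ_{k<n} (β_k − iα_k) w^{k+1}` the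
analytic polynomial of the trigonometric polynomial. [cite: Katznelson2004, Ch. III §1 (conformal covariance of the conjugate
function; trigonometric polynomials)] -/
theorem hilbertTransformCircle_trigPoly_moebius {ρ : ℝ} (hρ : |ρ| < 1) {φ : ℝ → ℝ}
    (hφ : ∀ y : ℝ, Complex.exp (φ y * I) = (Complex.exp (y * I) - ρ) / (1 - ρ * Complex.exp (y * I)))
    (n : ℕ) (c : ℝ) (α β : ℕ → ℝ) (x : ℝ) :
    hilbertTransformCircle (fun y => c + ∑ k ∈ Finset.range n,
        (α k * Real.sin (((k + 1 : ℕ) : ℝ) * φ y) + β k * Real.cos (((k + 1 : ℕ) : ℝ) * φ y))) x =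
      ∑ k ∈ Finset.range n, (-α k * Real.cos (((k + 1 : ℕ) : ℝ) * φ x) + β k * Real.sin (((k + 1 : ℕ) : ℝ) * φ x))
        + ∑ k ∈ Finset.range n, α k * (-ρ) ^ (k + 1) := by
  -- the analytic polynomial whose real part on the circle is the trigonometric polynomial
  set G : ℂ → ℂ := fun w => (c : ℂ) + ∑ k ∈ Finset.range n, (((β k : ℝ) : ℂ) - ((α k : ℝ) : ℂ) * I) * w ^ (k + 1)
    with hG
  have hGd : Differentiable ℂ G := by
    rw [hG]
    fun_prop
  have hre : ∀ θ : ℝ, (G (Complex.exp (θ * I))).re = c + ∑ k ∈ Finset.range n,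
      (α k * Real.sin (((k + 1 : ℕ) : ℝ) * θ) + β k * Real.cos (((k + 1 : ℕ) : ℝ) * θ)) := by
    intro θ
    simp only [hG, Complex.add_re, Complex.ofReal_re, Complex.re_sum, Complex.mul_re, Complex.sub_re, Complex.sub_im,
      Complex.ofReal_im, Complex.mul_im, Complex.I_re, Complex.I_im, exp_mul_I_pow_re', exp_mul_I_pow_im']
    congr 1
    refine Finset.sum_congr rfl fun k _ => ?_
    push_cast
    ring
  have h0 : (G 0).im = 0 := by
    simp [hG]
  have hρ' : (G (-ρ)).im = -∑ k ∈ Finset.range n, α k * (-ρ) ^ (k + 1) := by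
    simp only [hG, Complex.add_im, Complex.ofReal_im, Complex.im_sum, zero_add]
    rw [← Finset.sum_neg_distrib]
    refine Finset.sum_congr rfl fun k _ => ?_
    have h1 : ((-(ρ : ℂ)) ^ (k + 1)).im = 0 := by
      rw [← Complex.ofReal_neg, ← Complex.ofReal_pow, Complex.ofReal_im]
    have h2 : ((-(ρ : ℂ)) ^ (k + 1)).re = (-ρ) ^ (k + 1) := by
      rw [← Complex.ofReal_neg, ← Complex.ofReal_pow, Complex.ofReal_re]
    simp only [Complex.mul_im, Complex.sub_re, Complex.sub_im, Complex.ofReal_re, Complex.ofReal_im, Complex.mul_re,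
      Complex.I_re, Complex.I_im, h1, h2]
    ring
  have key := hilbertTransformCircle_re_moebius isOpen_univ (subset_univ _) hGd.differentiableOn hρ hφ x
  simp only [hre] at key
  rw [key, hilbertTransformCircle_trigPoly_eq n c α β (φ x), h0, hρ']
  ring

/-- The same for the explicit lift `φ_ρ(y) = y + 2 arctan(ρ sin y/(1 − ρ cos y))`.
[cite: Katznelson2004, Ch. III §1 (conformal covariance of the conjugate function; trigonometric polynomials)] -/
theorem hilbertTransformCircle_trigPoly_moebiusLift {ρ : ℝ} (hρ : |ρ| < 1) (n : ℕ) (c : ℝ) (α β : ℕ → ℝ) (x : ℝ) :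
    hilbertTransformCircle (fun y => c + ∑ k ∈ Finset.range n,
        (α k * Real.sin (((k + 1 : ℕ) : ℝ) * (y + 2 * Real.arctan (ρ * Real.sin y / (1 - ρ * Real.cos y))))
          + β k * Real.cos (((k + 1 : ℕ) : ℝ) * (y + 2 * Real.arctan (ρ * Real.sin y / (1 - ρ * Real.cos y)))))) x =
      ∑ k ∈ Finset.range n,
        (-α k * Real.cos (((k + 1 : ℕ) : ℝ) * (x + 2 * Real.arctan (ρ * Real.sin x / (1 - ρ * Real.cos x))))
          + β k * Real.sin (((k + 1 : ℕ) : ℝ) * (x + 2 * Real.arctan (ρ * Real.sin x / (1 - ρ * Real.cos x)))))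
        + ∑ k ∈ Finset.range n, α k * (-ρ) ^ (k + 1) :=
  hilbertTransformCircle_trigPoly_moebius hρ (φ := fun y => y + 2 * Real.arctan (ρ * Real.sin y / (1 - ρ * Real.cos y)))
    (cexp_moebiusLift_mul_I hρ) n c α β x

/-! ### Trigonometric polynomials: the analytic polynomial and almost-everywhere lifts -/

/-- A real trigonometric polynomial is the real part, on the unit circle, of its **analytic polynomial**:
`c + Σ_{k<n} (α_k sin((k+1)θ) + β_k cos((k+1)θ)) = Re G(e^{iθ})` with `G(w) = c + Σ_{k<n} (β_k − iα_k) w^{k+1}`.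
[cite: Katznelson2004, Ch. I §1 (trigonometric polynomials, exponential form)] -/
theorem trigPoly_eq_re_analyticPoly (n : ℕ) (c : ℝ) (α β : ℕ → ℝ) (θ : ℝ) :
    c + ∑ k ∈ Finset.range n, (α k * Real.sin (((k + 1 : ℕ) : ℝ) * θ) + β k * Real.cos (((k + 1 : ℕ) : ℝ) * θ))
      = ((c : ℂ) + ∑ k ∈ Finset.range n,
          (((β k : ℝ) : ℂ) - ((α k : ℝ) : ℂ) * I) * Complex.exp (θ * I) ^ (k + 1)).re := by
  simp only [Complex.add_re, Complex.ofReal_re, Complex.re_sum, Complex.mul_re, Complex.sub_re, Complex.sub_im,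
    Complex.ofReal_im, Complex.mul_im, Complex.I_re, Complex.I_im, exp_mul_I_pow_re', exp_mul_I_pow_im']
  congr 1
  refine Finset.sum_congr rfl fun k _ => ?_
  push_cast
  ring

/-- The analytic polynomial `G(w) = c + Σ_{k<n} (β_k − iα_k) w^{k+1}` at the real point `−ρ`:
`Im G(−ρ) = −Σ_{k<n} α_k (−ρ)^{k+1}` (and `Im G(0) = 0`). [cite: Katznelson2004, Ch. I §1 (trigonometric polynomials, exponential form)] -/
theorem analyticPoly_im_neg_real (n : ℕ) (c : ℝ) (α β : ℕ → ℝ) (ρ : ℝ) :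
    ((c : ℂ) + ∑ k ∈ Finset.range n, (((β k : ℝ) : ℂ) - ((α k : ℝ) : ℂ) * I) * (-(ρ : ℂ)) ^ (k + 1)).im
      = -∑ k ∈ Finset.range n, α k * (-ρ) ^ (k + 1) := by
  simp only [Complex.add_im, Complex.ofReal_im, Complex.im_sum, zero_add]
  rw [← Finset.sum_neg_distrib]
  refine Finset.sum_congr rfl fun k _ => ?_
  have h1 : ((-(ρ : ℂ)) ^ (k + 1)).im = 0 := by
    rw [← Complex.ofReal_neg, ← Complex.ofReal_pow, Complex.ofReal_im]
  have h2 : ((-(ρ : ℂ)) ^ (k + 1)).re = (-ρ) ^ (k + 1) := by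
    rw [← Complex.ofReal_neg, ← Complex.ofReal_pow, Complex.ofReal_re]
  simp only [Complex.mul_im, Complex.sub_re, Complex.sub_im, Complex.ofReal_re, Complex.ofReal_im, Complex.mul_re,
    Complex.I_re, Complex.I_im, h1, h2]
  ring

/-- **Conformal covariance for trigonometric polynomials, almost-everywhere lift.** As
`hilbertTransformCircle_trigPoly_moebius`, but the lift condition `e^{iφ(y)} = (e^{iy} − ρ)/(1 − ρe^{iy})` is only required for
a.e. `y` and at the evaluation point `x` — the form needed for the half-angle lift `2 arctan(s tan(y/2))`, which is a lift off the
null set `π + 2πℤ`. [cite: Katznelson2004, Ch. III §1 (conformal covariance of the conjugate function; trigonometric polynomials)] -/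
theorem hilbertTransformCircle_trigPoly_moebius_ae {ρ : ℝ} (hρ : |ρ| < 1) {φ : ℝ → ℝ}
    (hφ : ∀ᵐ y : ℝ, Complex.exp (φ y * I) = (Complex.exp (y * I) - ρ) / (1 - ρ * Complex.exp (y * I))) {x : ℝ}
    (hx : Complex.exp (φ x * I) = (Complex.exp (x * I) - ρ) / (1 - ρ * Complex.exp (x * I)))
    (n : ℕ) (c : ℝ) (α β : ℕ → ℝ) :
    hilbertTransformCircle (fun y => c + ∑ k ∈ Finset.range n,
        (α k * Real.sin (((k + 1 : ℕ) : ℝ) * φ y) + β k * Real.cos (((k + 1 : ℕ) : ℝ) * φ y))) x =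
      ∑ k ∈ Finset.range n, (-α k * Real.cos (((k + 1 : ℕ) : ℝ) * φ x) + β k * Real.sin (((k + 1 : ℕ) : ℝ) * φ x))
        + ∑ k ∈ Finset.range n, α k * (-ρ) ^ (k + 1) := by
  set G : ℂ → ℂ := fun w => (c : ℂ) + ∑ k ∈ Finset.range n, (((β k : ℝ) : ℂ) - ((α k : ℝ) : ℂ) * I) * w ^ (k + 1)
    with hG
  have hGd : Differentiable ℂ G := by
    rw [hG]
    fun_prop
  have hre : ∀ θ : ℝ, (G (Complex.exp (θ * I))).re = c + ∑ k ∈ Finset.range n,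
      (α k * Real.sin (((k + 1 : ℕ) : ℝ) * θ) + β k * Real.cos (((k + 1 : ℕ) : ℝ) * θ)) :=
    fun θ => (trigPoly_eq_re_analyticPoly n c α β θ).symm
  have h0 : (G 0).im = 0 := by
    simp [hG]
  have hρ' : (G (-ρ)).im = -∑ k ∈ Finset.range n, α k * (-ρ) ^ (k + 1) := analyticPoly_im_neg_real n c α β ρ
  have key := hilbertTransformCircle_re_moebius_ae isOpen_univ (subset_univ _) hGd.differentiableOn hρ hφ hx
  simp only [hre] at key
  rw [key, hilbertTransformCircle_trigPoly_eq n c α β (φ x), h0, hρ']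
  ring

end Literature.Analysis.Fourier
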